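import Mathlib
import Literature.Analysis.PDE.SingleEntropy.Semiconcavity
import HarnessLib

/-!
# From semiconcavity to the one-sided bound `uₓ ≤ K` in `𝒟'`

Topic `Literature/Analysis/PDE/SingleEntropy` — part of the formalization of
De Lellis–Otto–Westdickenberg, *Minimal entropy conditions for Burgers equation*, Quart. Appl.
Math. 62 (2004) 687–700, Thm 2.3 / Cor 2.5 (the named fact
`Literature.Analysis.PDE.deLellisOttoWestdickenberg_singleEntropy`).

* `second_difference_eq` / `second_difference_le`: the second symmetric difference
  `φ(y) + φ(-y) - 2φ(0)` of a `C²` function as a double integral of `φ''`, with bounds;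
* `oneSided_of_semiconcave`: if `h` is bounded Lipschitz with `∂ₓh = u` a.e. near `p₀` and
  `h(t,x+y)+h(t,x-y)-2h(t,x) ≤ K y²` there, then `-(K∫ψ) ≤ ∫ u ∂ₓψ` for smooth nonnegative `ψ`
  supported near `p₀` — i.e. Oleĭnik's one-sided bound `uₓ ≤ K` in `𝒟'` (second difference
  quotients, translation invariance, dominated convergence, and the integration by parts formula
  for Lipschitz functions). [folklore]
-/

noncomputable section

open MeasureTheory Set Filter Metric
open scoped Topology NNReal

namespace Literature.Analysis.PDE.SingleEntropy

/-! ## From semiconcavity to the one-sided bound `uₓ ≤ K` in `𝒟'` -/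

section OneSided

/-- Second symmetric difference as a double integral of the second derivative. [folklore] -/
theorem second_difference_eq {φ φ' φ'' : ℝ → ℝ} (hφ : ∀ s, HasDerivAt φ (φ' s) s)
    (hφ' : ∀ s, HasDerivAt φ' (φ'' s) s) (hc' : Continuous φ') (hc'' : Continuous φ'') (y c : ℝ) :
    φ y + φ (-y) - 2 * φ 0 - c * y ^ 2
      = ∫ σ in (0 : ℝ)..y, ∫ ρ in (-σ)..σ, (φ'' ρ - c) := by
  have f1 : φ y - φ 0 = ∫ σ in (0 : ℝ)..y, φ' σ := by
    rw [intervalIntegral.integral_eq_sub_of_hasDerivAt (fun s _ => hφ s) (hc'.intervalIntegrable _ _)]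
  have f2 : φ (-y) - φ 0 = -∫ σ in (0 : ℝ)..y, φ' (-σ) := by
    rw [intervalIntegral.integral_comp_neg (f := φ')]
    simp only [neg_zero]
    rw [intervalIntegral.integral_symm,
      intervalIntegral.integral_eq_sub_of_hasDerivAt (fun s _ => hφ s) (hc'.intervalIntegrable _ _)]
    ring
  have f3 : ∀ σ, φ' σ - φ' (-σ) = ∫ ρ in (-σ)..σ, φ'' ρ := fun σ => by
    rw [intervalIntegral.integral_eq_sub_of_hasDerivAt (fun s _ => hφ' s) (hc''.intervalIntegrable _ _)]
  have f4 : ∀ σ, ∫ ρ in (-σ)..σ, (φ'' ρ - c) = (φ' σ - φ' (-σ)) - 2 * c * σ := fun σ => by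
    rw [intervalIntegral.integral_sub (hc''.intervalIntegrable _ _) intervalIntegrable_const, ← f3,
      intervalIntegral.integral_const, smul_eq_mul]
    ring
  simp_rw [f4]
  have i1 : IntervalIntegrable (fun σ => φ' σ - φ' (-σ)) volume 0 y :=
    ((hc'.sub (hc'.comp continuous_neg)).intervalIntegrable _ _)
  have i2 : IntervalIntegrable (fun σ => 2 * c * σ) volume 0 y :=
    ((by fun_prop : Continuous fun σ : ℝ => 2 * c * σ).intervalIntegrable _ _)
  have i3 : IntervalIntegrable (fun σ => φ' σ) volume 0 y := hc'.intervalIntegrable _ _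
  have i4 : IntervalIntegrable (fun σ => φ' (-σ)) volume 0 y :=
    (hc'.comp continuous_neg).intervalIntegrable _ _
  rw [intervalIntegral.integral_sub i1 i2, intervalIntegral.integral_sub i3 i4,
    intervalIntegral.integral_const_mul, integral_id]
  have : φ y + φ (-y) - 2 * φ 0 = (φ y - φ 0) + (φ (-y) - φ 0) := by ring
  rw [this, f1, f2]
  ring

/-- Bound for the second symmetric difference. [folklore] -/
theorem second_difference_le {φ φ' φ'' : ℝ → ℝ} (hφ : ∀ s, HasDerivAt φ (φ' s) s)
    (hφ' : ∀ s, HasDerivAt φ' (φ'' s) s) (hc' : Continuous φ') (hc'' : Continuous φ'') {y c M : ℝ}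
    (hM : ∀ ρ, |ρ| ≤ |y| → |φ'' ρ - c| ≤ M) :
    |φ y + φ (-y) - 2 * φ 0 - c * y ^ 2| ≤ 2 * M * y ^ 2 := by
  rw [second_difference_eq hφ hφ' hc' hc'' y c]
  have hM0 : 0 ≤ M := (abs_nonneg _).trans (hM 0 (by simp))
  have inner : ∀ σ ∈ Set.uIoc 0 y, |∫ ρ in (-σ)..σ, (φ'' ρ - c)| ≤ 2 * M * |y| := by
    intro σ hσ
    have hσy : |σ| ≤ |y| := abs_le_abs_of_mem_uIoc hσ
    have := intervalIntegral.norm_integral_le_of_norm_le_const (a := -σ) (b := σ) (C := M)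
      (f := fun ρ => φ'' ρ - c) (fun ρ hρ => by
        rw [Real.norm_eq_abs]
        apply hM
        have hρσ : |ρ| ≤ |σ| := by
          rcases Set.mem_uIoc.mp hρ with ⟨h1, h2⟩ | ⟨h1, h2⟩
          · rw [abs_le]; constructor <;> cases le_total 0 σ <;>
              simp only [abs_of_nonneg, abs_of_nonpos, *] <;> linarith
          · rw [abs_le]; constructor <;> cases le_total 0 σ <;>
              simp only [abs_of_nonneg, abs_of_nonpos, *] <;> linarith
        exact hρσ.trans hσy)
    rw [Real.norm_eq_abs] at this
    calc |∫ ρ in (-σ)..σ, (φ'' ρ - c)| ≤ M * |σ - -σ| := this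
      _ = 2 * M * |σ| := by rw [sub_neg_eq_add, ← two_mul, abs_mul, abs_two]; ring
      _ ≤ 2 * M * |y| := by gcongr
  have := intervalIntegral.norm_integral_le_of_norm_le_const (a := 0) (b := y) (C := 2 * M * |y|)
    (f := fun σ => ∫ ρ in (-σ)..σ, (φ'' ρ - c)) (fun σ hσ => by rw [Real.norm_eq_abs]; exact inner σ hσ)
  rw [Real.norm_eq_abs, sub_zero] at this
  calc |∫ σ in (0 : ℝ)..y, ∫ ρ in (-σ)..σ, (φ'' ρ - c)| ≤ 2 * M * |y| * |y| := this
    _ = 2 * M * y ^ 2 := by rw [← sq_abs y]; ring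

end OneSided


/-- **Semiconcavity in `x` gives the one-sided bound `hₓₓ ≤ K`, i.e. `uₓ ≤ K`, in `𝒟'`.**
If `h` is bounded and Lipschitz with `∂ₓh = u` a.e. on `ball p₀ R₁`, and
`h(t,x+y) + h(t,x-y) - 2h(t,x) ≤ K y²` for `|t - p₀.1|, |x - p₀.2|, |y| < r₀ ≤ R₁`, then for every
smooth nonnegative `ψ` supported in `ball p₀ (r₀/2)`: `-(K ∫ψ) ≤ ∫ u ∂ₓψ` (second difference
quotients, translation invariance and dominated convergence; integration by parts for the
Lipschitz function `h`). [folklore] -/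
theorem oneSided_of_semiconcave {h : ℝ × ℝ → ℝ} {L : ℝ≥0} (hh : LipschitzWith L h) {Bh : ℝ}
    (hBh : ∀ z, |h z| ≤ Bh) {u : ℝ × ℝ → ℝ}
    {p₀ : ℝ × ℝ} {R₁ r₀ K : ℝ} (hr₀ : 0 < r₀) (hrR : r₀ ≤ R₁)
    (hae : ∀ᵐ z ∂(volume : Measure (ℝ × ℝ)), z ∈ ball p₀ R₁ →
      DifferentiableAt ℝ h z ∧ fderiv ℝ h z (0, 1) = u z)
    (hsc : ∀ t x y, |t - p₀.1| < r₀ → |x - p₀.2| < r₀ → |y| < r₀ →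
      h (t, x + y) + h (t, x - y) - 2 * h (t, x) ≤ K * y ^ 2)
    {ψ : ℝ × ℝ → ℝ} (hψ : ContDiff ℝ (⊤ : ℕ∞) ψ) (hψc : HasCompactSupport ψ)
    (hψs : tsupport ψ ⊆ ball p₀ (r₀ / 2)) (hψ0 : ∀ z, 0 ≤ ψ z) :
    -(K * ∫ z, ψ z) ≤ ∫ z, u z * fderiv ℝ ψ z (0, 1) := by
  -- the derivatives of `ψ`
  set e₂ : ℝ × ℝ := (0, 1) with he₂
  have hψ1 : Differentiable ℝ ψ := hψ.differentiable (by simp)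
  set ψx : ℝ × ℝ → ℝ := fun z => fderiv ℝ ψ z e₂ with hψx
  have hψxs : ContDiff ℝ (⊤ : ℕ∞) ψx := by
    have := hψ.fderiv_right (m := (⊤ : ℕ∞)) (by simp)
    exact this.clm_apply contDiff_const
  have hψx1 : Differentiable ℝ ψx := hψxs.differentiable (by simp)
  have hψxc : HasCompactSupport ψx := hψc.fderiv_apply ℝ e₂
  set ψxx : ℝ × ℝ → ℝ := fun z => fderiv ℝ ψx z e₂ with hψxx
  have hψxxs : ContDiff ℝ (⊤ : ℕ∞) ψxx := by
    have := hψxs.fderiv_right (m := (⊤ : ℕ∞)) (by simp)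
    exact this.clm_apply contDiff_const
  have hψxxc : HasCompactSupport ψxx := hψxc.fderiv_apply ℝ e₂
  have hψxx_cont : Continuous ψxx := hψxxs.continuous
  obtain ⟨B, hB⟩ := hψxxc.exists_bound_of_continuous hψxx_cont
  have hB' : ∀ z, |ψxx z| ≤ B := fun z => by simpa [Real.norm_eq_abs] using hB z
  have hB0 : 0 ≤ B := (abs_nonneg _).trans (hB' 0)
  -- supports
  have hψxts : tsupport ψx ⊆ tsupport ψ := tsupport_fderiv_apply_subset ℝ e₂
  have hball : ball p₀ (r₀ / 2) ⊆ ball p₀ R₁ := ball_subset_ball (by linarith)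
  ----------------------------------------------------------------
  -- Step 1: `∫ u ψₓ = -∫ h ψₓₓ`
  ----------------------------------------------------------------
  have step1 : ∫ z, u z * ψx z = -∫ z, h z * ψxx z := by
    have e1 : ∫ z, u z * ψx z = ∫ z, lineDeriv ℝ h z e₂ * ψx z := by
      apply integral_congr_ae
      filter_upwards [hae] with z hz
      by_cases hzs : z ∈ tsupport ψ
      · obtain ⟨hd, hfx⟩ := hz (hball (hψs hzs))
        rw [hd.lineDeriv_eq_fderiv, hfx]
      · have : ψx z = 0 := image_eq_zero_of_notMem_tsupport (fun h' => hzs (hψxts h'))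
        simp [this]
    obtain ⟨D, hD⟩ := ContDiff.lipschitzWith_of_hasCompactSupport hψxc (hψxs.of_le (by simp) :
      ContDiff ℝ 1 ψx) one_ne_zero
    have ibp := hh.integral_lineDeriv_mul_eq (μ := volume) hD hψxc e₂
    have e2 : ∀ z, lineDeriv ℝ ψx z (-e₂) = -ψxx z := fun z => by
      rw [(hψx1 z).lineDeriv_eq_fderiv, map_neg]
    simp_rw [e2] at ibp
    rw [e1, ibp, ← integral_neg]
    congr 1; funext z; ring
  rw [show (fun z => u z * fderiv ℝ ψ z (0, 1)) = fun z => u z * ψx z from rfl, step1]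
  rw [neg_le_neg_iff]
  ----------------------------------------------------------------
  -- Step 2: second differences
  ----------------------------------------------------------------
  -- the 1D slices of `ψ`
  have slice : ∀ z : ℝ × ℝ, (∀ s : ℝ, HasDerivAt (fun s : ℝ => ψ (z + s • e₂)) (ψx (z + s • e₂)) s) ∧
      (∀ s : ℝ, HasDerivAt (fun s : ℝ => ψx (z + s • e₂)) (ψxx (z + s • e₂)) s) := by
    intro z
    have hl : ∀ s : ℝ, HasDerivAt (fun s : ℝ => z + s • e₂) e₂ s := fun s => by
      simpa using ((hasDerivAt_id s).smul_const e₂).const_add z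
    refine ⟨fun s => ?_, fun s => ?_⟩
    · exact (hψ1 (z + s • e₂)).hasFDerivAt.comp_hasDerivAt s (hl s)
    · exact (hψx1 (z + s • e₂)).hasFDerivAt.comp_hasDerivAt s (hl s)
  -- second difference bound and limit
  have sd_bound : ∀ z (y : ℝ), |ψ (z + y • e₂) + ψ (z + (-y) • e₂) - 2 * ψ z| ≤ 2 * B * y ^ 2 := by
    intro z y
    obtain ⟨s1, s2⟩ := slice z
    have := second_difference_le (φ := fun s => ψ (z + s • e₂)) s1 s2
      ((hψxs.continuous).comp (by fun_prop)) (hψxx_cont.comp (by fun_prop)) (y := y) (c := 0)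
      (M := B) (fun ρ _ => by rw [sub_zero]; exact hB' _)
    simpa using this
  have sd_lim : ∀ z, Tendsto (fun y : ℝ => (ψ (z + y • e₂) + ψ (z + (-y) • e₂) - 2 * ψ z) / y ^ 2)
      (𝓝[≠] 0) (𝓝 (ψxx z)) := by
    intro z
    obtain ⟨s1, s2⟩ := slice z
    rw [Metric.tendsto_nhdsWithin_nhds]
    intro ε' hε'
    have hc : ContinuousAt (fun s : ℝ => ψxx (z + s • e₂)) 0 := (hψxx_cont.comp (by fun_prop)).continuousAt
    obtain ⟨δ, hδ, hδ'⟩ := Metric.continuousAt_iff.mp hc (ε' / 4) (by positivity)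
    refine ⟨δ, hδ, fun y hy0 hy => ?_⟩
    have hy0' : y ≠ 0 := hy0
    have hyδ : |y| < δ := by simpa [Real.dist_eq] using hy
    have key := second_difference_le (φ := fun s => ψ (z + s • e₂)) s1 s2
      ((hψxs.continuous).comp (by fun_prop)) (hψxx_cont.comp (by fun_prop)) (y := y) (c := ψxx z)
      (M := ε' / 4) (fun ρ hρ => by
        have : dist ρ 0 < δ := by rw [Real.dist_eq, sub_zero]; exact lt_of_le_of_lt hρ hyδ
        have := hδ' this
        simp only [zero_smul, add_zero] at this
        rw [Real.dist_eq] at this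
        exact this.le)
    simp only [zero_smul, add_zero] at key
    rw [Real.dist_eq]
    have hy2 : 0 < y ^ 2 := by positivity
    rw [div_sub' (ne_of_gt hy2), abs_div, abs_of_pos hy2, div_lt_iff₀ hy2]
    calc |ψ (z + y • e₂) + ψ (z + -y • e₂) - 2 * ψ z - y ^ 2 * ψxx z|
        = |ψ (z + y • e₂) + ψ (z + -y • e₂) - 2 * ψ z - ψxx z * y ^ 2| := by ring_nf
      _ ≤ 2 * (ε' / 4) * y ^ 2 := by simpa [neg_smul] using key
      _ < ε' * y ^ 2 := by nlinarith
  ----------------------------------------------------------------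
  -- Step 3: the sequence of second difference quotients
  ----------------------------------------------------------------
  set yn : ℕ → ℝ := fun n => r₀ / (4 * ((n : ℝ) + 1)) with hyn
  have hyn_pos : ∀ n, 0 < yn n := fun n => by simp only [hyn]; positivity
  have hyn_lt : ∀ n, yn n < r₀ := fun n => by
    simp only [hyn]; rw [div_lt_iff₀ (by positivity)]; nlinarith
  have hyn_tend : Tendsto yn atTop (𝓝[≠] 0) := by
    refine tendsto_nhdsWithin_iff.mpr ⟨?_, Eventually.of_forall fun n => (hyn_pos n).ne'⟩
    have := (tendsto_const_div_atTop_nhds_zero_nat (r₀ / 4)).comp (tendsto_add_atTop_nat 1)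
    refine this.congr (fun n => ?_)
    simp only [hyn, Function.comp_apply]; push_cast; field_simp
  -- integrability helpers
  have hint_shift : ∀ (c : ℝ × ℝ), Integrable (fun z => h z * ψ (z + c)) volume := fun c =>
    (hh.continuous.mul (hψ.continuous.comp (continuous_add_const c))).integrable_of_hasCompactSupport
      ((hψc.comp_homeomorph (Homeomorph.addRight c)).mul_left)
  have hint0 : Integrable (fun z => h z * ψ z) volume :=
    (hh.continuous.mul hψ.continuous).integrable_of_hasCompactSupport hψc.mul_left
  have hintψ : Integrable ψ volume := hψ.continuous.integrable_of_hasCompactSupport hψc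
  -- (B1)+(B2): the shifted form and the semiconcavity bound
  have hAn : ∀ n, ∫ z, h z * (ψ (z + yn n • e₂) + ψ (z + (-yn n) • e₂) - 2 * ψ z)
      ≤ K * (yn n) ^ 2 * ∫ z, ψ z := by
    intro n
    set y := yn n with hy
    have e1 : ∫ z, h z * ψ (z + y • e₂) = ∫ z, h (z - y • e₂) * ψ z := by
      rw [← integral_sub_right_eq_self (μ := volume) (fun z => h z * ψ (z + y • e₂)) (y • e₂)]
      congr 1; funext z; simp
    have e2 : ∫ z, h z * ψ (z + (-y) • e₂) = ∫ z, h (z + y • e₂) * ψ z := by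
      rw [← integral_add_right_eq_self (μ := volume) (fun z => h z * ψ (z + (-y) • e₂)) (y • e₂)]
      congr 1; funext z; simp [neg_smul]
    have iA : Integrable (fun z => h (z - y • e₂) * ψ z) volume :=
      ((hh.continuous.comp (continuous_sub_right _)).mul hψ.continuous).integrable_of_hasCompactSupport
        hψc.mul_left
    have iB : Integrable (fun z => h (z + y • e₂) * ψ z) volume :=
      ((hh.continuous.comp (continuous_add_const _)).mul hψ.continuous).integrable_of_hasCompactSupport
        hψc.mul_left
    have split : ∫ z, h z * (ψ (z + y • e₂) + ψ (z + (-y) • e₂) - 2 * ψ z)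
        = (∫ z, h z * ψ (z + y • e₂)) + (∫ z, h z * ψ (z + (-y) • e₂)) - 2 * ∫ z, h z * ψ z := by
      have e : (fun z => h z * (ψ (z + y • e₂) + ψ (z + (-y) • e₂) - 2 * ψ z))
          = fun z => (h z * ψ (z + y • e₂) + h z * ψ (z + (-y) • e₂)) - 2 * (h z * ψ z) := by
        funext z; ring
      rw [e, integral_sub ((hint_shift _).fun_add (hint_shift _)) (hint0.const_mul 2),
        integral_add (hint_shift _) (hint_shift _), integral_const_mul]
    have comb : ∫ z, (h (z - y • e₂) + h (z + y • e₂) - 2 * h z) * ψ z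
        = (∫ z, h (z - y • e₂) * ψ z) + (∫ z, h (z + y • e₂) * ψ z) - 2 * ∫ z, h z * ψ z := by
      have e : (fun z => (h (z - y • e₂) + h (z + y • e₂) - 2 * h z) * ψ z)
          = fun z => (h (z - y • e₂) * ψ z + h (z + y • e₂) * ψ z) - 2 * (h z * ψ z) := by
        funext z; ring
      rw [e, integral_sub (iA.fun_add iB) (hint0.const_mul 2), integral_add iA iB, integral_const_mul]
    rw [split, e1, e2, ← comb]
    have i3 : Integrable (fun z => (h (z - y • e₂) + h (z + y • e₂) - 2 * h z) * ψ z) volume := by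
      have e : (fun z => (h (z - y • e₂) + h (z + y • e₂) - 2 * h z) * ψ z)
          = fun z => (h (z - y • e₂) * ψ z + h (z + y • e₂) * ψ z) - 2 * (h z * ψ z) := by
        funext z; ring
      rw [e]; exact (iA.fun_add iB).sub (hint0.const_mul 2)
    have := integral_mono i3 (hintψ.const_mul (K * y ^ 2)) (fun z => ?_)
    · rwa [integral_const_mul] at this
    · simp only
      by_cases hz : ψ z = 0
      · simp [hz]
      · have hzs : z ∈ tsupport ψ := by
          by_contra h'; exact hz (image_eq_zero_of_notMem_tsupport h')
        have hzb := hψs hzs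
        rw [mem_ball, Prod.dist_eq, max_lt_iff, Real.dist_eq, Real.dist_eq] at hzb
        have key := hsc z.1 z.2 y (by linarith [hzb.1]) (by linarith [hzb.2])
          (by rw [abs_of_pos (hyn_pos n)]; exact hyn_lt n)
        have ea : z - y • e₂ = (z.1, z.2 - y) := by ext <;> simp [he₂]
        have eb : z + y • e₂ = (z.1, z.2 + y) := by ext <;> simp [he₂]
        rw [ea, eb]
        have ez : h z = h (z.1, z.2) := rfl
        rw [ez]
        have key' : h (z.1, z.2 - y) + h (z.1, z.2 + y) - 2 * h (z.1, z.2) ≤ K * y ^ 2 := by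
          linarith [key]
        exact mul_le_mul_of_nonneg_right key' (hψ0 z)
  ----------------------------------------------------------------
  -- Step 4: dominated convergence for the difference quotients
  ----------------------------------------------------------------
  have hBh0 : 0 ≤ Bh := (abs_nonneg _).trans (hBh 0)
  set Kc : Set (ℝ × ℝ) := cthickening r₀ (tsupport ψ) with hKc
  have hKcc : IsCompact Kc := hψc.cthickening
  have he₂n : ‖e₂‖ = 1 := by simp [he₂, Prod.norm_def]
  have hvanish : ∀ n, ∀ z ∉ Kc, ψ (z + yn n • e₂) + ψ (z + (-yn n) • e₂) - 2 * ψ z = 0 := by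
    intro n z hz
    have far : ∀ c : ℝ × ℝ, ‖c‖ ≤ r₀ → ψ (z + c) = 0 := by
      intro c hc
      apply image_eq_zero_of_notMem_tsupport
      intro hmem
      apply hz
      exact mem_cthickening_of_dist_le z (z + c) r₀ _ hmem (by simpa [dist_eq_norm] using hc)
    have n1 : ‖yn n • e₂‖ ≤ r₀ := by
      rw [norm_smul, he₂n, mul_one, Real.norm_eq_abs, abs_of_pos (hyn_pos n)]; exact (hyn_lt n).le
    have n2 : ‖(-yn n) • e₂‖ ≤ r₀ := by
      rw [norm_smul, he₂n, mul_one, Real.norm_eq_abs, abs_neg, abs_of_pos (hyn_pos n)]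
      exact (hyn_lt n).le
    have n3 := far 0 (by simp; exact hr₀.le)
    rw [add_zero] at n3
    rw [far _ n1, far _ n2, n3]; ring
  have lim : Tendsto (fun n => ∫ z, h z * ((ψ (z + yn n • e₂) + ψ (z + (-yn n) • e₂) - 2 * ψ z)
      / (yn n) ^ 2)) atTop (𝓝 (∫ z, h z * ψxx z)) := by
    refine tendsto_integral_of_dominated_convergence (Kc.indicator fun _ => Bh * (2 * B)) ?_ ?_ ?_ ?_
    · intro n
      exact (hh.continuous.mul ((((hψ.continuous.comp (continuous_add_const _)).add
        (hψ.continuous.comp (continuous_add_const _))).sub (continuous_const.mul hψ.continuous)).div_const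
        _)).aestronglyMeasurable
    · rw [integrable_indicator_iff hKcc.measurableSet]
      exact integrableOn_const (hKcc.measure_lt_top.ne)
    · intro n
      refine ae_of_all _ fun z => ?_
      by_cases hz : z ∈ Kc
      · rw [indicator_of_mem hz, norm_mul, norm_div, Real.norm_eq_abs, Real.norm_eq_abs, Real.norm_eq_abs,
          abs_of_pos (by positivity : 0 < (yn n) ^ 2)]
        have h1 := sd_bound z (yn n)
        have h2 : |ψ (z + yn n • e₂) + ψ (z + -yn n • e₂) - 2 * ψ z| / (yn n) ^ 2 ≤ 2 * B := by
          rw [div_le_iff₀ (by positivity)]; simpa [neg_smul] using h1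
        exact mul_le_mul (hBh z) h2 (by positivity) hBh0
      · rw [indicator_of_notMem hz]
        have := hvanish n z hz
        simp only [neg_smul] at this ⊢
        rw [this]; simp
    · refine ae_of_all _ fun z => ?_
      have := (sd_lim z).comp hyn_tend
      exact tendsto_const_nhds.mul this
  ----------------------------------------------------------------
  -- Step 5: conclusion
  ----------------------------------------------------------------
  have hle : ∀ n, ∫ z, h z * ((ψ (z + yn n • e₂) + ψ (z + (-yn n) • e₂) - 2 * ψ z) / (yn n) ^ 2)
      ≤ K * ∫ z, ψ z := by
    intro n
    have hy2 : 0 < (yn n) ^ 2 := by positivity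
    have e : ∫ z, h z * ((ψ (z + yn n • e₂) + ψ (z + (-yn n) • e₂) - 2 * ψ z) / (yn n) ^ 2)
        = (∫ z, h z * (ψ (z + yn n • e₂) + ψ (z + (-yn n) • e₂) - 2 * ψ z)) / (yn n) ^ 2 := by
      rw [← integral_div]; congr 1; funext z; ring
    rw [e, div_le_iff₀ hy2]
    calc ∫ z, h z * (ψ (z + yn n • e₂) + ψ (z + (-yn n) • e₂) - 2 * ψ z)
        ≤ K * (yn n) ^ 2 * ∫ z, ψ z := hAn n
      _ = K * (∫ z, ψ z) * (yn n) ^ 2 := by ring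
  exact le_of_tendsto' lim hle



end Literature.Analysis.PDE.SingleEntropy
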